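import Mathlib
import Summits.NavierStokesRegularity.NavierStokesRegularity.Theorems.EulerZoomLiouvillePowerGaugeEulerLiouvilleSelfSimilarBinderReductions
import Summits.NavierStokesRegularity.NavierStokesRegularity.Theorems.EulerZoomLiouvillePowerGaugeEulerLiouvilleSelfSimilarGauges
import Summits.NavierStokesRegularity.NavierStokesRegularity.Theorems.EulerZoomLiouvillePowerGaugeEulerLiouvilleSpacePeriodic
import HarnessLib

/-!
# The binder `¬ IsSymmetricWeak` of the self-similar stubs of `EulerZoomLiouville.PowerGaugeEulerLiouville`
# is decorative: the screw disjunct, and the assembled reduction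

Route №10 `EulerZoomLiouville` (NavierStokesRegularity), crux E = stmt-NavierStokesRegularity-19832,
registered open stubs `stub_selfSimilarC2Needle` / `stub_selfSimilarWeakRest`.  Sequel of
`…SelfSimilarBinderReductions` (time-periodic / traveling-wave disjuncts ⇒ homogeneous profile):

* `Binders.norm_profile_translate_of_screw` — if the slices of an exactly self-similar field
  `u(τ) = (−τ)^{γ−1} V((−τ)^{−γ}·)` have SCREW-SYMMETRIC MODULUS, `‖u τ (L(y − y₀) + y₀ + w)‖ = ‖u τ y‖`
  (`L` a linear isometry, `L w = w ≠ 0`), then `‖V‖` is invariant under the translate by the axis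
  offset `d = y₀ − L y₀ + w ≠ 0` (`screwOffset_ne_zero`: `⟪d, w⟫ = ‖w‖²`): in profile variables the
  symmetry at time `τ` is the screw motion `z ↦ L z + (−τ)^{−γ} d`, and the motions at the two scales
  `(−τ)^{−γ} = 1, 2` share the linear part `L`, so their quotient is the translation by `d`;
* `Binders.lintegral_ball_profile_eq_zero_of_screw` — with the `A`-gauge `a^{2ρ} A(a) ≤ c` (`ρ > 0`)
  the profile then vanishes on every ball: the slice `u(−1) = V` has PERIODIC MODULUS, and the tree's
  packing argument `SpacePeriodic.slice_ball_eq_zero_of_periodic` applies to the auxiliary field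
  `‖u‖ • e₀` (same gauge, same slice moduli); hence `Binders.not_extremal_of_selfSimilar_of_screw`;
* `Binders.not_symmetricWeak_of_selfSimilar` — **the assembled reduction**, shapes verbatim:
  `InClass ρ u p H c → (∀ τ < 0, u τ = selfSimilarCollapse (1/(2+ρ)) 0 V τ) → IsExtremalProfile ρ V →
  ¬ IsHomogeneousProfile ρ V → ¬ IsSymmetricWeak u H` — so the LEAD may drop `¬ IsSymmetricWeak u H`
  from both self-similar stubs (and, by `…BinderReductions`, `¬ IsHomogeneousProfile ρ V` from THE ONE
  STATEMENT, whose profile is `C²`).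

WHAT THIS IS NOT: not NS, not E, not a stub — bookkeeping for the skeleton; `--supports` stmt-19832.
[folklore]
-/

noncomputable section

-- flat `Theorems/<Route><Decl>…` files of one crux share the namespace of the crux (tree convention)
set_option linter.dupNamespace false

open MeasureTheory Set Filter Topology Metric Function
open scoped ENNReal NNReal

namespace Summit.NavierStokesRegularity.NavierStokesRegularity.Theorems.PowerGaugeEulerLiouville

open Literature.Analysis Literature.Analysis.FluidPDE

namespace Binders

section Screw

variable {V : EuclideanSpace ℝ (Fin 3) → EuclideanSpace ℝ (Fin 3)}
  {u : ℝ → EuclideanSpace ℝ (Fin 3) → EuclideanSpace ℝ (Fin 3)}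

/-- The axis offset of a genuine screw motion is nonzero: if `L` is a linear isometry with `L w = w`,
`w ≠ 0`, then `y₀ − L y₀ + w ≠ 0` (indeed `⟪y₀ − L y₀ + w, w⟫ = ‖w‖²`, since `⟪L y₀, w⟫ = ⟪L y₀, L w⟫ =
⟪y₀, w⟫`). [folklore] -/
theorem screwOffset_ne_zero (L : EuclideanSpace ℝ (Fin 3) ≃ₗᵢ[ℝ] EuclideanSpace ℝ (Fin 3))
    {y₀ w : EuclideanSpace ℝ (Fin 3)} (hw : w ≠ 0) (hLw : L w = w) : y₀ - L y₀ + w ≠ 0 := by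
  intro h
  have hinner : inner ℝ (y₀ - L y₀ + w) w = ‖w‖ ^ 2 := by
    rw [inner_add_left, inner_sub_left, real_inner_self_eq_norm_sq]
    have : inner ℝ (L y₀) w = inner ℝ y₀ w := by
      conv_lhs => rw [← hLw]
      exact L.inner_map_map y₀ w
    rw [this, sub_self, zero_add]
  rw [h, inner_zero_left] at hinner
  exact hw (by
    have : ‖w‖ ^ 2 = 0 := hinner.symm
    exact norm_eq_zero.1 (pow_eq_zero_iff two_ne_zero |>.1 this))

/-- **Screw-symmetric modulus of a self-similar field: the profile modulus at one scale.**  If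
`u(τ) = (−τ)^{γ−1} V((−τ)^{−γ}·)` (`τ < 0`) and `‖u τ (L(y − y₀) + y₀ + w)‖ = ‖u τ y‖`, then with
`s = (−τ)^{−γ}`: `‖V (L z + s • (y₀ − L y₀ + w))‖ = ‖V z‖` for all `z`. [folklore] -/
theorem norm_profile_screw_of_slice {γ τ : ℝ} (hτ : τ < 0)
    (hu : ∀ τ : ℝ, τ < 0 → u τ = selfSimilarCollapse γ 0 V τ)
    (L : EuclideanSpace ℝ (Fin 3) ≃ₗᵢ[ℝ] EuclideanSpace ℝ (Fin 3)) {y₀ w : EuclideanSpace ℝ (Fin 3)}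
    (hscrew : ∀ y : EuclideanSpace ℝ (Fin 3), ‖u τ (L (y - y₀) + y₀ + w)‖ = ‖u τ y‖)
    (z : EuclideanSpace ℝ (Fin 3)) :
    ‖V (L z + (0 - τ) ^ (-γ) • (y₀ - L y₀ + w))‖ = ‖V z‖ := by
  have h0τ : 0 < 0 - τ := by linarith
  set s : ℝ := (0 - τ) ^ (-γ) with hs
  have hs0 : 0 < s := Real.rpow_pos_of_pos h0τ _
  have hk : 0 < (0 - τ) ^ (γ - 1) := Real.rpow_pos_of_pos h0τ _
  have h := hscrew (s⁻¹ • z)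
  rw [hu τ hτ, selfSimilarCollapse_apply, selfSimilarCollapse_apply, norm_smul, norm_smul,
    Real.norm_of_nonneg hk.le] at h
  have h' := mul_left_cancel₀ hk.ne' h
  rw [← hs, smul_smul, mul_inv_cancel₀ hs0.ne', one_smul] at h'
  rw [← h']
  congr 2
  simp only [smul_add, smul_sub, map_sub, LinearIsometryEquiv.map_smul, smul_smul,
    mul_inv_cancel₀ hs0.ne', one_smul]
  abel

/-- **Screw-symmetric modulus of a self-similar field: the profile modulus is invariant under the
translate by the axis offset.**  If `u(τ) = (−τ)^{γ−1} V((−τ)^{−γ}·)` for `τ < 0` (`γ > 0`) and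
`‖u τ (L(y − y₀) + y₀ + w)‖ = ‖u τ y‖` for all `τ < 0`, `y`, then `‖V (x + (y₀ − L y₀ + w))‖ = ‖V x‖`
for all `x` (the screw motions at the scales `s = 1, 2` have the same linear part `L`; their quotient
is the translation by the offset). [folklore] -/
theorem norm_profile_translate_of_screw {γ : ℝ} (hγ : 0 < γ)
    (hu : ∀ τ : ℝ, τ < 0 → u τ = selfSimilarCollapse γ 0 V τ)
    (L : EuclideanSpace ℝ (Fin 3) ≃ₗᵢ[ℝ] EuclideanSpace ℝ (Fin 3)) {y₀ w : EuclideanSpace ℝ (Fin 3)}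
    (hscrew : ∀ τ : ℝ, τ < 0 → ∀ y : EuclideanSpace ℝ (Fin 3), ‖u τ (L (y - y₀) + y₀ + w)‖ = ‖u τ y‖)
    (x : EuclideanSpace ℝ (Fin 3)) :
    ‖V (x + (y₀ - L y₀ + w))‖ = ‖V x‖ := by
  set d : EuclideanSpace ℝ (Fin 3) := y₀ - L y₀ + w with hd
  -- scale `1` (`τ = -1`) and scale `2` (`τ = -2^{-1/γ}`)
  have h1 : ∀ z : EuclideanSpace ℝ (Fin 3), ‖V (L z + d)‖ = ‖V z‖ := by
    intro z
    have h := norm_profile_screw_of_slice (by norm_num : (-1 : ℝ) < 0) hu L (hscrew (-1) (by norm_num)) z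
    rwa [show (0 : ℝ) - -1 = 1 by ring, Real.one_rpow, one_smul] at h
  set τ₂ : ℝ := -((2 : ℝ) ^ (-(1 / γ))) with hτ₂
  have hτ₂0 : τ₂ < 0 := by rw [hτ₂]; exact neg_neg_of_pos (Real.rpow_pos_of_pos two_pos _)
  have hs2 : (0 - τ₂) ^ (-γ) = 2 := by
    rw [hτ₂, show (0 : ℝ) - -((2 : ℝ) ^ (-(1 / γ))) = (2 : ℝ) ^ (-(1 / γ)) by ring,
      ← Real.rpow_mul (by norm_num : (0 : ℝ) ≤ 2), show -(1 / γ) * -γ = 1 by field_simp,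
      Real.rpow_one]
  have h2 : ∀ z : EuclideanSpace ℝ (Fin 3), ‖V (L z + (2 : ℝ) • d)‖ = ‖V z‖ := by
    intro z
    have h := norm_profile_screw_of_slice hτ₂0 hu L (hscrew τ₂ hτ₂0) z
    rwa [hs2] at h
  -- `x = L x' + d` with `x' = L.symm (x - d)`; then `x + d = L x' + 2 • d`
  set x' : EuclideanSpace ℝ (Fin 3) := L.symm (x - d) with hx'
  have hx1 : L x' + d = x := by rw [hx', L.apply_symm_apply, sub_add_cancel]
  have hx2 : L x' + (2 : ℝ) • d = x + d := by rw [two_smul, ← add_assoc, hx1]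
  rw [← hx2, h2 x', ← hx1, h1 x']

/-- **Screw-symmetric modulus ⇒ the profile vanishes on every ball** (`ρ > 0`): for an exactly
self-similar field (`γ = 1/(2+ρ)`) whose `A`-gauge is bounded, `a^{2ρ} A(a) ≤ c` for all `a > 0`,
and whose slices have screw-symmetric modulus (`L w = w ≠ 0`), `∫_{B_R} ‖V‖² = 0` (in `ℝ≥0∞`) for
every `R > 0`: the modulus of the slice `u(−1) = V` is periodic with the nonzero period
`y₀ − L y₀ + w` (`norm_profile_translate_of_screw`), and a slice with periodic modulus dies by packing
against the `A`-gauge (`SpacePeriodic.slice_ball_eq_zero_of_periodic`, applied to the auxiliary field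
`‖u‖ • e₀`). [folklore] -/
theorem lintegral_ball_profile_eq_zero_of_screw {ρ : ℝ} (hρ : 0 < ρ) {c : ℝ≥0}
    (hu : ∀ τ : ℝ, τ < 0 → u τ = selfSimilarCollapse (1 / (2 + ρ)) 0 V τ)
    (hA : ∀ a : ℝ, 0 < a →
      ENNReal.ofReal (a ^ (2 * ρ)) * cknA a (0 : ℝ × EuclideanSpace ℝ (Fin 3)) u ≤ (c : ℝ≥0∞))
    (L : EuclideanSpace ℝ (Fin 3) ≃ₗᵢ[ℝ] EuclideanSpace ℝ (Fin 3)) {y₀ w : EuclideanSpace ℝ (Fin 3)}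
    (hw : w ≠ 0) (hLw : L w = w)
    (hscrew : ∀ τ : ℝ, τ < 0 → ∀ y : EuclideanSpace ℝ (Fin 3), ‖u τ (L (y - y₀) + y₀ + w)‖ = ‖u τ y‖)
    {R : ℝ} (hR : 0 < R) :
    ∫⁻ x in ball (0 : EuclideanSpace ℝ (Fin 3)) R, ‖V x‖ₑ ^ 2 = 0 := by
  have h2ρ : (0 : ℝ) < 2 + ρ := by linarith
  have hγ : (0 : ℝ) < 1 / (2 + ρ) := by positivity
  set d : EuclideanSpace ℝ (Fin 3) := y₀ - L y₀ + w with hd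
  have hd0 : d ≠ 0 := screwOffset_ne_zero L hw hLw
  -- the auxiliary field `ũ = ‖u‖ • e₀` with the same gauge and norm-slices
  set e₀ : EuclideanSpace ℝ (Fin 3) := ‖w‖⁻¹ • w with he₀
  have he₀n : ‖e₀‖ = 1 := by
    rw [he₀, norm_smul, norm_inv, norm_norm, inv_mul_cancel₀ (norm_ne_zero_iff.2 hw)]
  set ut : ℝ → EuclideanSpace ℝ (Fin 3) → EuclideanSpace ℝ (Fin 3) := fun t x => ‖u t x‖ • e₀ with hut
  have hnorm : ∀ t x, ‖ut t x‖ = ‖u t x‖ := by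
    intro t x
    rw [hut]
    simp only [norm_smul, Real.norm_eq_abs, abs_norm, he₀n, mul_one]
  have henorm : ∀ t x, ‖ut t x‖ₑ = ‖u t x‖ₑ := by
    intro t x
    rw [← ofReal_norm, ← ofReal_norm, hnorm]
  have hAt : ∀ a : ℝ, 0 < a →
      ENNReal.ofReal (a ^ (2 * ρ)) * cknA a (0 : ℝ × EuclideanSpace ℝ (Fin 3)) ut ≤ (c : ℝ≥0∞) := by
    intro a ha
    have hck : cknA a (0 : ℝ × EuclideanSpace ℝ (Fin 3)) ut = cknA a (0 : ℝ × EuclideanSpace ℝ (Fin 3)) u := by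
      unfold cknA
      simp_rw [henorm]
    rw [hck]
    exact hA a ha
  -- the slice `τ = -1` of `ũ` is periodic with period `d`
  have hV1 : u (-1) = V := by
    rw [hu (-1) (by norm_num)]
    funext x
    rw [selfSimilarCollapse_apply, show (0 : ℝ) - -1 = 1 by ring, Real.one_rpow, Real.one_rpow,
      one_smul, one_smul]
  have hper : ∀ y, ut (-1) (y + d) = ut (-1) y := by
    intro y
    show ‖u (-1) (y + d)‖ • e₀ = ‖u (-1) y‖ • e₀
    rw [hV1, norm_profile_translate_of_screw hγ hu L hscrew y]
  have h := SpacePeriodic.slice_ball_eq_zero_of_periodic hρ hAt hd0 (by norm_num : (-1 : ℝ) < 0) hper hR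
  simp_rw [henorm, hV1] at h
  exact h

/-- **The screw disjunct of `¬ IsSymmetricWeak` is decorative in the self-similar stubs**: an exactly
self-similar field with bounded `A`-gauge, measurable profile and screw-symmetric modulus has a
profile vanishing a.e., hence NOT extremal (shapes verbatim). [folklore] -/
theorem not_extremal_of_selfSimilar_of_screw {ρ : ℝ} (hρ : 0 < ρ) {c : ℝ≥0}
    (hu : ∀ τ : ℝ, τ < 0 → u τ = selfSimilarCollapse (1 / (2 + ρ)) 0 V τ)
    (hA : ∀ a : ℝ, 0 < a →
      ENNReal.ofReal (a ^ (2 * ρ)) * cknA a (0 : ℝ × EuclideanSpace ℝ (Fin 3)) u ≤ (c : ℝ≥0∞))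
    (hVm : AEStronglyMeasurable V volume)
    (L : EuclideanSpace ℝ (Fin 3) ≃ₗᵢ[ℝ] EuclideanSpace ℝ (Fin 3)) {y₀ w : EuclideanSpace ℝ (Fin 3)}
    (hw : w ≠ 0) (hLw : L w = w)
    (hscrew : ∀ τ : ℝ, τ < 0 → ∀ y : EuclideanSpace ℝ (Fin 3), ‖u τ (L (y - y₀) + y₀ + w)‖ = ‖u τ y‖) :
    ¬ (∃ ε : ℝ, 0 < ε ∧ ∃ L₀ : ℝ, ∀ L : ℝ, L₀ ≤ L →
      ε ≤ L ^ (2 * ρ - 1) * ∫ y in Metric.ball (0 : EuclideanSpace ℝ (Fin 3)) L, ‖V y‖ ^ 2) := by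
  rintro ⟨ε, hε, L₀, hL⟩
  set L₁ : ℝ := max L₀ 1 with hL₁
  have hL₁0 : 0 < L₁ := lt_of_lt_of_le one_pos (le_max_right _ _)
  have h0 := lintegral_ball_profile_eq_zero_of_screw hρ hu hA L hw hLw hscrew hL₁0
  -- `∫_{B_{L₁}} ‖V‖² = 0` as a real integral
  have hae : (fun y => ‖V y‖ ^ 2) =ᵐ[volume.restrict (ball (0 : EuclideanSpace ℝ (Fin 3)) L₁)] 0 := by
    have hm : AEMeasurable (fun y => ‖V y‖ₑ ^ 2) (volume.restrict (ball (0 : EuclideanSpace ℝ (Fin 3)) L₁)) :=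
      (hVm.restrict.enorm.pow_const 2)
    have h := (lintegral_eq_zero_iff' hm).1 h0
    filter_upwards [h] with y hy
    have hy' : ‖V y‖ₑ ^ 2 = 0 := hy
    rw [pow_eq_zero_iff two_ne_zero, enorm_eq_zero] at hy'
    simp [hy']
  have hint : ∫ y in Metric.ball (0 : EuclideanSpace ℝ (Fin 3)) L₁, ‖V y‖ ^ 2 = 0 :=
    integral_eq_zero_of_ae hae
  have h := hL L₁ (le_max_left _ _)
  rw [hint, mul_zero] at h
  exact absurd h (not_le.2 hε)

end Screw

section Member

/-- **The binder `¬ IsSymmetricWeak u H` is decorative in both self-similar stubs.**  For a member of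
the crux's class (`0 < ρ`; only the `A`-gauge and the measurability of `u` carried by the weak gradient
are used) which is exactly self-similar about the origin with an EXTREMAL profile that is NOT
critically homogeneous, none of the three disjuncts of `IsSymmetricWeak u H` can hold: time-periodic
⇒ homogeneous profile, traveling wave ⇒ homogeneous profile, screw-symmetric modulus ⇒ profile zero on
every ball ⇒ not extremal.  Shapes verbatim (`InClass`'s three clauses as separate hypotheses,
`IsExactlySelfSimilar`'s velocity clause, `IsExtremalProfile`, `IsHomogeneousProfile`,
`IsSymmetricWeak`). [folklore] -/
theorem not_symmetricWeak_of_selfSimilar {ρ : ℝ} (hρ : 0 < ρ)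
    {u : ℝ → EuclideanSpace ℝ (Fin 3) → EuclideanSpace ℝ (Fin 3)} {p : ℝ → EuclideanSpace ℝ (Fin 3) → ℝ}
    {H : ℝ → EuclideanSpace ℝ (Fin 3) → EuclideanSpace ℝ (Fin 3) →L[ℝ] EuclideanSpace ℝ (Fin 3)} {c : ℝ≥0}
    (_hsw : IsSuitableWeakSolutionOn (slab (EuclideanSpace ℝ (Fin 3)) (Iio 0) isOpen_Iio) 0 0 u p)
    (hH : HasWeakSpatialGradientOn (slab (EuclideanSpace ℝ (Fin 3)) (Iio 0) isOpen_Iio) u H)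
    (hgauge : ∀ a : ℝ, 0 < a →
      ENNReal.ofReal (a ^ (2 * ρ)) * cknA a (0 : ℝ × EuclideanSpace ℝ (Fin 3)) u +
          ENNReal.ofReal (a ^ ρ) * cknE a (0 : ℝ × EuclideanSpace ℝ (Fin 3)) H +
        ENNReal.ofReal (a ^ (2 * ρ)) * cknD a (0 : ℝ × EuclideanSpace ℝ (Fin 3)) p ≤ (c : ℝ≥0∞))
    {V : EuclideanSpace ℝ (Fin 3) → EuclideanSpace ℝ (Fin 3)}
    (hu : ∀ τ : ℝ, τ < 0 → u τ = selfSimilarCollapse (1 / (2 + ρ)) 0 V τ)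
    (hext : ∃ ε : ℝ, 0 < ε ∧ ∃ L₀ : ℝ, ∀ L : ℝ, L₀ ≤ L →
      ε ≤ L ^ (2 * ρ - 1) * ∫ y in Metric.ball (0 : EuclideanSpace ℝ (Fin 3)) L, ‖V y‖ ^ 2)
    (hnh : ¬ ∀ s : ℝ, 0 < s → ∀ y : EuclideanSpace ℝ (Fin 3), V (s • y) = s ^ (-(1 + ρ)) • V y) :
    ¬ ((∃ P : ℝ, 0 < P ∧ ∀ τ : ℝ, τ < 0 → u (τ - P) = u τ) ∨
      (∃ (U : EuclideanSpace ℝ (Fin 3) → EuclideanSpace ℝ (Fin 3))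
          (G₀ : EuclideanSpace ℝ (Fin 3) → EuclideanSpace ℝ (Fin 3) →L[ℝ] EuclideanSpace ℝ (Fin 3))
          (b : EuclideanSpace ℝ (Fin 3)),
          u = (fun τ y => U (y - τ • b)) ∧ H = fun τ y => G₀ (y - τ • b)) ∨
      ∃ (L : EuclideanSpace ℝ (Fin 3) ≃ₗᵢ[ℝ] EuclideanSpace ℝ (Fin 3)) (y₀ w : EuclideanSpace ℝ (Fin 3)),
        w ≠ 0 ∧ L w = w ∧
          ∀ τ : ℝ, τ < 0 → ∀ y : EuclideanSpace ℝ (Fin 3), ‖u τ (L (y - y₀) + y₀ + w)‖ = ‖u τ y‖) := by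
  have hA : ∀ a : ℝ, 0 < a → ENNReal.ofReal (a ^ (2 * ρ)) *
      cknA a (0 : ℝ × EuclideanSpace ℝ (Fin 3)) u ≤ (c : ℝ≥0∞) :=
    fun a ha => le_trans (le_trans le_self_add le_self_add) (hgauge a ha)
  have hum : AEStronglyMeasurable (uncurry u)
      (volume.restrict (Iio (0 : ℝ) ×ˢ (univ : Set (EuclideanSpace ℝ (Fin 3))))) := by
    have := hH.locallyIntegrableOn.aestronglyMeasurable
    simpa [slab] using this
  have hVm := aestronglyMeasurable_profile hum hu
  rintro (hper | htrav | ⟨L, y₀, w, hw, hLw, hscrew⟩)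
  · exact not_timePeriodic_of_selfSimilar_of_not_homogeneous hρ hu hnh hper
  · exact not_travelingWave_of_selfSimilar_of_not_homogeneous (H := H) hρ hu hnh htrav
  · exact not_extremal_of_selfSimilar_of_screw hρ hu hA hVm L hw hLw hscrew hext

end Member

end Binders

end Summit.NavierStokesRegularity.NavierStokesRegularity.Theorems.PowerGaugeEulerLiouville

end
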